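import Summits.RiemannHypothesis.RiemannHypothesis.Theorems.JensenPolynomialsEffectiveKimLee
import Mathlib.Analysis.SpecialFunctions.Log.Monotone
import HarnessLib

/-!
# Effective Kim–Lee for `ξ₁`: the explicit radius `(n / log n)² / 64` for `n ≥ 2¹⁶`

RH-FREE (line 1, cell rh-jensen discipline; bears_on LADDER-RH J-P, the column's next rung «explicit
Kim–Lee band»; nothing here bears on the truth of RH — under RH every `ξ₁⁽ⁿ⁾` has only real zeros
and the statements are vacuous; the content is RH-free complex analysis plus real arithmetic).

Main result (`xiSq_derivZeros_nonreal_far`, the cell's shape `XiDerivNonrealZeroFar (1/64) 65536`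
of `HOME/rh-jensen-idea-2/NegationLensSketch.lean`, unfolded):

  for every `n ≥ 65536 = 2¹⁶` and every zero `w` of `ξ₁⁽ⁿ⁾` with `Im w ≠ 0`:
  `(1/64) · (n / log n)² ≤ ‖w‖`.

Equivalently (`xiSq_derivZeros_real_below`): every zero of `ξ₁⁽ⁿ⁾` of modulus `< (n / log n)²/64`
is real. This is Kim–Lee 2021, Thm. 2 (ii) («the zeros of `Ξ₀⁽ⁿ⁾` in `Re z < n^{2-ε}`… are real for
`n` large», ineffective) made effective with the sharp `log`: the window `(n/log n)²` has the shape
of the truth (the consumed-zeros edge `γ_{n+1}² ≍ n²/log² n`), the constant `1/64` does not.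

Proof: the master form `EffectiveKimLee.xiSq_derivZeros_real_of_explicit` with `R = q²/64`,
`q = n / log n`, and the auxiliary radius `r = (q/2 - 3/2)²`; the two hypotheses reduce to
(a) `(1+e²)(R+¼) + (1+2e²)(1+√n)(1+√n+q/8) ≤ (q/2-3/2)²`, which follows from
`√n ≤ (log 2/16)·q` (Mathlib `Real.log_div_sqrt_antitoneOn` on `[2¹⁶, ∞)`) and `q ≥ 5909`, and
(b) `log 16 + 6 + (2q-4)(log q - log 2) < 2n = 2q log n`, i.e. `8 log 2 + 6 + 4 log L < 2q(log L +
log 2) + 4L` with `L = log n ≥ 16 log 2`. The threshold `2¹⁶` is what these two crude slicings give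
(the true threshold of the master inequality at `c = 1/64` is `n ≈ 8.3·10³`); nothing downstream
needs a smaller one.

Provenance: cell rh-jensen (idea-2 NEGATION-LENS §2 «B2 effective Kim–Lee», crux instance
`(1/64, n₁)`), prover-rh-jensen-eng-2-g4-0, 2026-08-26. AI-produced formalisation; AI review is
weaker than expert review. References: Y.-O. Kim, J. Lee, arXiv:2105.05386, Thm. 2 (ii);
H. Ki, Y.-O. Kim, Duke Math. J. 104 (2000) §2.
-/

noncomputable section

open Complex Filter Set

set_option linter.dupNamespace false

namespace Summit.RiemannHypothesis.RiemannHypothesis.Theorems.JensenPolynomials.EffectiveKimLee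

open Literature.NumberTheory.LFunctions

/-! ## Numeric constants -/

/-- `e² ≤ 7.3891`. -/
theorem exp_two_le : Real.exp 2 ≤ 7.3891 := by
  have h := Real.exp_one_lt_d9
  have h0 : 0 < Real.exp 1 := Real.exp_pos 1
  have h2 : Real.exp 2 = Real.exp 1 * Real.exp 1 := by rw [← Real.exp_add]; norm_num
  rw [h2]; nlinarith

/-- `log 65536 = 16 log 2`. -/
theorem log_65536 : Real.log 65536 = 16 * Real.log 2 := by
  rw [show (65536 : ℝ) = 2 ^ 16 by norm_num, Real.log_pow]; norm_num

/-- `√65536 = 256`. -/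
theorem sqrt_65536 : Real.sqrt 65536 = 256 := by
  rw [show (65536 : ℝ) = 256 ^ 2 by norm_num, Real.sqrt_sq (by norm_num)]

/-- `e² ≤ 65536`. -/
theorem exp_two_le_65536 : Real.exp 2 ≤ 65536 := exp_two_le.trans (by norm_num)

/-! ## The slicing lemmas for `x ≥ 2¹⁶`: `L = log x`, `q = x / L` -/

/-- For `x ≥ 65536`: `log x / √x ≤ log 2 / 16` (the function `log x/√x` decreases on `[e², ∞)`).
-/
theorem log_div_sqrt_le {x : ℝ} (hx : 65536 ≤ x) : Real.log x / Real.sqrt x ≤ Real.log 2 / 16 := by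
  have h := Real.log_div_sqrt_antitoneOn (a := 65536) (b := x) exp_two_le_65536
    (exp_two_le_65536.trans hx) hx
  simp only at h
  rw [log_65536, sqrt_65536] at h
  linarith

/-- For `x ≥ 65536`: `16 log 2 ≤ log x`, hence `11.09 ≤ log x`. -/
theorem log_ge {x : ℝ} (hx : 65536 ≤ x) : 11.09 ≤ Real.log x := by
  have h1 : Real.log 65536 ≤ Real.log x := Real.log_le_log (by norm_num) hx
  rw [log_65536] at h1
  have h2 := Real.log_two_gt_d9
  linarith

/-! ## The radius theorem -/

/-- **Effective Kim–Lee for `ξ₁` with the explicit radius (RH-FREE).** For `n ≥ 65536` every zero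
`w` of `ξ₁⁽ⁿ⁾` with `Im w ≠ 0` satisfies `(1/64)(n / log n)² ≤ ‖w‖`. -/
theorem xiSq_derivZeros_nonreal_far (n : ℕ) (hn : 65536 ≤ n) :
    ∀ w : ℂ, iteratedDeriv n xiSq w = 0 → w.im ≠ 0 →
      1 / 64 * ((n : ℝ) / Real.log n) ^ 2 ≤ ‖w‖ := by
  intro w hw him
  -- real bookkeeping: `x = n`, `L = log x ≥ 11.09`, `q = x / L`
  have hx65536 : (65536 : ℝ) ≤ (n : ℝ) := by exact_mod_cast hn
  have hxpos : 0 < (n : ℝ) := by linarith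
  have hL11 : 11.09 ≤ Real.log n := log_ge hx65536
  have hLpos : 0 < Real.log n := by linarith
  set x : ℝ := (n : ℝ) with hx
  set L : ℝ := Real.log x with hL
  set q : ℝ := x / L with hq
  have hqpos : 0 < q := div_pos hxpos hLpos
  have hxqL : x = q * L := by rw [hq]; field_simp
  -- `√x ≤ 0.0433217 q`, `256 ≤ √x`, hence `q ≥ 5909`
  have hl2hi := Real.log_two_lt_d9
  have hl2lo := Real.log_two_gt_d9
  have hsx0 : 0 < Real.sqrt x := Real.sqrt_pos.2 hxpos
  have h256 : 256 ≤ Real.sqrt x := by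
    rw [← sqrt_65536]; exact Real.sqrt_le_sqrt hx65536
  have hsxq : Real.sqrt x = q * (L / Real.sqrt x) := by
    rw [hq, div_mul_div_comm, mul_comm x L, ← div_mul_div_comm, div_self hLpos.ne', one_mul,
      Real.div_sqrt]
  have hε : L / Real.sqrt x ≤ Real.log 2 / 16 := log_div_sqrt_le hx65536
  have hsx : Real.sqrt x ≤ 0.0433217 * q := by
    have h1 : L / Real.sqrt x ≤ 0.0433217 := by linarith
    calc Real.sqrt x = q * (L / Real.sqrt x) := hsxq
      _ ≤ q * 0.0433217 := mul_le_mul_of_nonneg_left h1 hqpos.le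
      _ = 0.0433217 * q := mul_comm _ _
  have hq5909 : 5909 ≤ q := by linarith
  have hq2 : (5909 : ℝ) * 5909 ≤ q ^ 2 := by nlinarith
  -- the two radii `R = (q/8)²` and `r = (q/2 - 3/2)²`
  have hRq : 1 / 64 * q ^ 2 = (q / 8) ^ 2 := by ring
  have hRpos : 0 < 1 / 64 * q ^ 2 := by positivity
  have hsqrtR : Real.sqrt (1 / 64 * q ^ 2) = q / 8 := by rw [hRq, Real.sqrt_sq (by positivity)]
  set t : ℝ := q / 2 - 3 / 2 with ht
  have ht0 : 0 ≤ t := by rw [ht]; linarith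
  have hsqrtr : Real.sqrt (t ^ 2) = t := Real.sqrt_sq ht0
  -- (a) the chain radius is at most `r = t²`
  have hs : 1 + Real.sqrt x ≤ 0.0435 * q := by linarith
  have hs0 : 0 ≤ 1 + Real.sqrt x := by positivity
  set V : ℝ := (1 + Real.sqrt x) * (1 + Real.sqrt x + Real.sqrt (1 / 64 * q ^ 2)) with hV
  have hVb : V ≤ 0.00733 * q ^ 2 := by
    rw [hV, hsqrtR]
    calc (1 + Real.sqrt x) * (1 + Real.sqrt x + q / 8)
        ≤ (0.0435 * q) * (0.0435 * q + q / 8) :=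
          mul_le_mul hs (by linarith) (by positivity) (by positivity)
      _ = 0.00732975 * q ^ 2 := by ring
      _ ≤ 0.00733 * q ^ 2 := mul_le_mul_of_nonneg_right (by norm_num) (sq_nonneg q)
  have hV0 : 0 ≤ V := by rw [hV, hsqrtR]; positivity
  have he2 := exp_two_le
  have hchain : (1 / 64 * q ^ 2 + V + 1 / 4) + Real.exp 2 * (1 / 64 * q ^ 2 + 2 * V + 1 / 4)
      ≤ t ^ 2 := by
    have hpos : 0 ≤ 1 / 64 * q ^ 2 + 2 * V + 1 / 4 := by positivity
    have h1 : (1 / 64 * q ^ 2 + V + 1 / 4) + Real.exp 2 * (1 / 64 * q ^ 2 + 2 * V + 1 / 4) ≤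
        (1 / 64 * q ^ 2 + V + 1 / 4) + 7.3891 * (1 / 64 * q ^ 2 + 2 * V + 1 / 4) :=
      add_le_add le_rfl (mul_le_mul_of_nonneg_right he2 hpos)
    have h2 : (1 / 64 * q ^ 2 + V + 1 / 4) + 7.3891 * (1 / 64 * q ^ 2 + 2 * V + 1 / 4) ≤
        0.2468 * q ^ 2 := by linarith
    have h3 : 0.2468 * q ^ 2 ≤ t ^ 2 := by
      rw [ht]; nlinarith
    linarith
  -- (b) the exponent inequality
  have hineq : 16 * Real.exp 6 *
      Real.exp (4 * (1 / 2 + Real.sqrt (t ^ 2)) * Real.log (3 / 2 + Real.sqrt (t ^ 2)))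
      < Real.exp (2 * (n : ℝ)) := by
    rw [hsqrtr]
    have hq2' : 3 / 2 + t = q / 2 := by rw [ht]; ring
    have hq1 : 1 / 2 + t = q / 2 - 1 := by rw [ht]; ring
    rw [hq2', hq1]
    have hlogq2 : Real.log (q / 2) = Real.log q - Real.log 2 :=
      Real.log_div hqpos.ne' two_ne_zero
    have hlogq : Real.log q = L - Real.log L := by
      rw [hq, Real.log_div hxpos.ne' hLpos.ne']
    have h16 : (16 : ℝ) * Real.exp 6 = Real.exp (4 * Real.log 2 + 6) := by
      rw [Real.exp_add, show (4 : ℝ) * Real.log 2 = Real.log (2 ^ 4) by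
        rw [Real.log_pow]; norm_num, Real.exp_log (by norm_num)]
      norm_num
    rw [h16, ← Real.exp_add, Real.exp_lt_exp, hlogq2, hlogq, show (n : ℝ) = x from rfl, hxqL]
    -- goal: 4 log 2 + 6 + 4 (q/2 - 1) (L - log L - log 2) < 2 (q L)
    have hlogL1 : Real.log L ≤ L - 1 := Real.log_le_sub_one_of_pos hLpos
    have hlogL0 : 0 ≤ Real.log L := Real.log_nonneg (by linarith)
    have hA : 0 ≤ q * Real.log L := mul_nonneg hqpos.le hlogL0
    have hB : (5909 : ℝ) * 0.6931471803 ≤ q * Real.log 2 :=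
      mul_le_mul hq5909 hl2lo.le (by norm_num) hqpos.le
    linarith
  -- conclude by the master form with `R = q²/64`, `r = t²`
  have hn1 : 1 ≤ n := le_trans (by norm_num) hn
  exact xiSq_derivZeros_real_of_explicit hn1 hRpos (r := t ^ 2) hchain hineq w hw him

/-- The same, in the shape `XiDerivNonrealZeroFar (1/64) 65536` of the cell's sketch (radius `0`,
i.e. no claim, below the threshold). -/
theorem xiSq_derivZeros_nonreal_far' (n : ℕ) (w : ℂ) (hw : iteratedDeriv n xiSq w = 0)
    (him : w.im ≠ 0) :
    (if 65536 ≤ n then 1 / 64 * ((n : ℝ) / Real.log n) ^ 2 else 0) ≤ ‖w‖ := by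
  split_ifs with h
  · exact xiSq_derivZeros_nonreal_far n h w hw him
  · exact norm_nonneg w

/-- Contrapositive form: for `n ≥ 65536`, every zero of `ξ₁⁽ⁿ⁾` of modulus `< (n / log n)²/64` is
real. -/
theorem xiSq_derivZeros_real_below (n : ℕ) (hn : 65536 ≤ n) (w : ℂ)
    (hw : iteratedDeriv n xiSq w = 0) (hlt : ‖w‖ < 1 / 64 * ((n : ℝ) / Real.log n) ^ 2) :
    w.im = 0 := by
  by_contra him
  exact absurd (xiSq_derivZeros_nonreal_far n hn w hw him) (not_le.2 hlt)

end Summit.RiemannHypothesis.RiemannHypothesis.Theorems.JensenPolynomials.EffectiveKimLee
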